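import Literature.Analysis.FluidPDE.TaoCascadeBlowupDynamicsWith
import HarnessLib

/-!
# Tao's cascade ODE: the rescaled inductive step (Prop. 6.5)

T. Tao, *Finite time blowup for an averaged three-dimensional Navier–Stokes equation*,
J. Amer. Math. Soc. 29 (2016), 601–674; arXiv:1402.0290v3, §6.4 "Fourth step: renormalising the
dynamics", Prop. 6.5 (arXiv v3 pp. 55–57, displays (6.43)–(6.81)). Equation numbers are those of
arXiv v3 (see the module docstring of `TaoCascadeBlowupDynamicsWith.lean` for the offset used by the
older sibling files).

Prop. 6.5 is the form in which the inductive step Prop. 6.4 is actually proved (§6.5–6.7): after the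
rescaling (6.82)–(6.83) the checkpoint `(t_N, e_N)` becomes `(0, 1)`, the scale `N` becomes `k = 0`, and
the viscosity enters only through factors `(1+ε₀)^{-n₀/2}`. This file packages its hypotheses (i)–(ix)
and its conclusion as structures (`RescaledHypotheses γ`, `RescaledConclusion γ`, in the
`X₃`-coefficient `γ` of (6.56)/(6.71); printed: `10⁻⁵ exp(-K¹⁰)`; author-corrected:
`10⁻⁵ exp(-K¹⁰/2)`, see `TaoCascadeBlowupDynamicsWith.lean`) and states the statement schema
`rescaledStepWith γ`, whose quantifier prefix chooses `K₀` (and `e₀`) uniformly in the implied constant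
`C₃` of (6.53) — see "Verdict clean-up" below for why this is stronger than the source. The
source-faithful schema `rescaledStepWith' γ` (`C₃` fixed before `K₀`) and the live named fact
`rescaledStepCorrected'` are in `TaoCascadeRescaledStepOrder.lean` (which imports this file, so they
cannot be restated here), together with the deduction Prop. 6.4 ⇐ Prop. 6.5 ("It is then routine to
verify that the conclusions of Proposition 6.4 are satisfied with
`t_{N+1} := t_N + (1+ε₀)^{-5N/2} e_N^{-1} τ₁` and `e_{N+1} := μ₁ e_N`", p. 59); the proof of Prop. 6.5
itself (Lemmas 6.7–6.10, Cor. 6.11, Props. 6.12–6.17, §6.5–6.7) is NOT here.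

## Verdict clean-up (2026-08-15): the two closed instances are deprecated

* `rescaledStepCorrected` (`γ K = 10⁻⁵ exp(-K¹⁰/2)`, uniform quantifier prefix) is MIS-STATED relative
  to the source. §6.1 (opening paragraph): "we allow all implied constants in the `O()` notation to depend
  on `ε₀` … a large constant `K ≥ 1`, which we assume to be sufficiently large depending on `ε₀`"; so
  the constant of the hypothesis (6.53) is an `ε₀`-level quantity which `K` may dominate, and the
  printed proof uses this: in the proof of Prop. 6.13 (§6.6, (6.120)–(6.125)) the crude bound (6.120)
  `Ẽ₁(t) ≲ K^{-30}/(1+|t|³)` for `τ_{n₀-N} ≤ t ≤ 0` is obtained "from this and (6.53)", its constant is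
  polynomial in that of (6.53), it propagates to `|b₁(t)| ≲ K^{-30} ε/(1+|t|²)` (`t ≤ 0`), and the
  bootstrap `∫ |b₁| ≤ ε/10` is closed by "this is inconsistent with (6.121) if `K` is [large] enough".
  With `K₀` chosen before `C₃` (as in `rescaledStepWith`) the rescaled past `[τ_{n₀-N}, 0]` may be
  arbitrarily long compared with `K` and the argument does not apply. Corrected statement:
  `rescaledStepCorrected'` := `rescaledStepWith' (fun K => 10⁻⁵ exp(-K¹⁰/2))` with
  `∀ ε₀, ∀ C₃ ≥ 0, ∃ K₀, ∀ K ≥ K₀, ∃ e₀ > 0, ∀ ε ∈ (0,e₀], ∀ C₁ C₂ ≥ 0, ∃ N₀, …`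
  (`TaoCascadeRescaledStepOrder.lean`); `rescaledStepCorrected → rescaledStepCorrected'` is
  `rescaledStepCorrected.weaken` there.
* `rescaledStepPrinted` (`γ K = 10⁻⁵ exp(-K¹⁰)`) is MIS-STATED twice over: the same quantifier prefix,
  and the printed constant of (6.56)/(6.71), which the printed proof does not deliver (Prop. 6.12 ⇐
  Props. 6.13 + 6.15, and (6.117) only gives `|c₁(t)| ≲ K^{-1/4} exp(-K¹⁰/2) ε²`; reader's report of
  2017-03-31 and the author's acknowledgment "this will be corrected in the next version of the ms.",
  arXiv v3 being the latest). Corrected statement: again `rescaledStepCorrected'`.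
* Both deprecated instances keep their bodies (they have users: `rescaledStepCorrected.weaken`,
  `noGlobalODESolution_of_rescaledStepCorrected` in `TaoCascadeRescaledStepOrder.lean`;
  `rescaledStepPrinted_of_corrected`, `rescaledStepPrinted_iff_not_rescaledHypotheses` in
  `TaoCascadeRescaledIteration.lean`). What is proved about them stands: by
  `not_rescaledHypotheses_of_rescaledStepWith` (iteration of the step + the blow-up argument of §6.2),
  `rescaledStepWith γ` is equivalent to the non-existence, for `K ≥ K₀(ε₀)` chosen before the constant of
  (6.53), of data obeying (i)–(ix)_γ — a uniformity the source neither states (under its §6.1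
  convention) nor proves.
* The schema `rescaledStepWith γ` itself (a parametrised predicate, not a named fact) is kept with its
  body, its docstring corrected accordingly.

## Packaging

* modes `a_k, b_k, c_k, d_k ↦ Y 0 k, Y 1 k, Y 2 k, Y 3 k` (`Y : Fin 4 → ℤ → ℝ → ℝ`), energies
  `Ẽ_k ↦ F k`, rescaled checkpoint times `τ : ℤ → ℝ` (constrained on `[n₀-N, 0]`, `τ 0 = 0`,
  `τ_{k-1} < τ_k`); the functions live on `[τ_{n₀-N}, +∞) ↦ Set.Ici (τ (n₀ - N))`, are `C¹` there
  (`ContDiffOn ℝ 1`), and derivatives are `derivWithin _ (Ici (τ (n₀ - N)))`, as in `TaoODESystem`;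
* the implied constants of the `O()` terms in (6.45)–(6.48), (6.51), (6.53) — on which `n₀` is allowed
  to depend ("`n₀` sufficiently large depending on `ε₀, K, ε`, and the implied constants in
  (6.45)–(6.48), (6.51), (6.53)") — are explicit parameters `C₁, C₂, C₃ ≥ 0`;
* `10^{-5} ↦ 1/10^5`, `K^{-10} ↦ (K^10)⁻¹`, `(1+ε₀)^{x} ↦ Real.rpow` for non-natural exponents,
  `|k| ↦ |(k : ℝ)|`; "for all `m ≥ 2`" ranges over `m : ℕ`.

## References

* T. Tao, J. Amer. Math. Soc. 29 (2016), 601–674 = arXiv:1402.0290v3, §6.1, opening paragraph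
  (conventions on implied constants and on `K`), §6.4 Prop. 6.5 (6.43)–(6.81), (6.82)–(6.84), Remark 6.6, p. 59, §6.6
  Prop. 6.13 (6.115)–(6.125). [`Tao2016AveragedNS`]
* T. Tao, blog page of the paper (What's new, 4 Feb 2014), reader comment of 31 March 2017 and the
  author's reply (the erratum to (6.17)/(6.32)/(6.71)/(6.108)). [`TaoBlog2014AveragedNSErratum`]
-/

noncomputable section

open Set MeasureTheory

namespace Literature.Analysis.FluidPDE

namespace TaoCascade

/-! ## Hypotheses (i)–(ix) of Proposition 6.5 -/

/-- **Hypotheses (i)–(ix), (6.43)–(6.66), of Tao's Prop. 6.5 (rescaled inductive step)** for rescaled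
times `τ_{n₀-N} < … < τ₀ = 0`, modes `a_k, b_k, c_k, d_k ↦ Y 0 k, …, Y 3 k` and energies `Ẽ_k ↦ F k`
on `[τ_{n₀-N}, +∞)`, with dyadic parameter `ε₀`, coupling `K`, `ε`, implied constants `C₁` (for
(6.45)–(6.48)), `C₂` (for (6.51)), `C₃` (for (6.53)), initial scale `n₀`, level `N`, and
`X₃`-coefficient `γ` in (6.56):
(i) a priori regularity (6.43)–(6.44); (ii) the equations of motion (6.45)–(6.48) with errors
`O((1+ε₀)^{2k-n₀/2} Ẽ_k^{1/2})` and the energy inequality (6.49); (iii) initial conditions (6.50)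
`a_k = … = Ẽ_k = 0` at `τ_{n₀-N}` for `k > n₀-N`; (iv) energy defect (6.51); (v) no very low frequencies
(6.52); (vii) scale evolution (6.53) `-O((1+ε₀)^{(5/2+1/100)|k|}) ≤ τ_k ≤ 0` for `n₀-N ≤ k ≤ 0`;
(viii) transition state (6.54)–(6.59) at `k = 0`, `t = 0` (with (6.56)_γ `|c₀(0)| ≤ γ ε²`) and, if
`N > n₀`, the additional bounds (6.60)–(6.63) at `k = -1`; (ix) the energy estimates (6.64)–(6.66) for
`n₀-N < k ≤ 0`, `τ_{k-1} ≤ t ≤ τ_k`. (There is no item (vi) in the source.)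
[cite: Tao2016AveragedNS, §6.4 Prop. 6.5 (6.43)–(6.66)] -/
structure RescaledHypotheses (γ ε₀ K ε C₁ C₂ C₃ : ℝ) (n₀ N : ℤ) (τ : ℤ → ℝ)
    (Y : Fin 4 → ℤ → ℝ → ℝ) (F : ℤ → ℝ → ℝ) : Prop where
  /-- `τ₀ = 0`. -/
  tau_zero : τ 0 = 0
  /-- `τ_{n₀-N} < … < τ₀`: consecutive rescaled times increase. -/
  tau_lt : ∀ k, n₀ - N < k → k ≤ 0 → τ (k - 1) < τ k
  /-- `a_k, b_k, c_k, d_k` are continuously differentiable on `[τ_{n₀-N}, +∞)`. -/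
  contDiffOn_Y : ∀ i k, ContDiffOn ℝ 1 (Y i k) (Ici (τ (n₀ - N)))
  /-- `Ẽ_k` is continuously differentiable on `[τ_{n₀-N}, +∞)`. -/
  contDiffOn_F : ∀ k, ContDiffOn ℝ 1 (F k) (Ici (τ (n₀ - N)))
  /-- `Ẽ_k` takes values in `[0, +∞)`. -/
  nonneg_F : ∀ k t, τ (n₀ - N) ≤ t → 0 ≤ F k t
  /-- (6.43): a priori regularity of the modes. -/
  apriori_Y : ∀ T : ℝ, τ (n₀ - N) < T → ∃ M : ℝ, ∀ t ∈ Icc (τ (n₀ - N)) T, ∀ k : ℤ,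
    (1 + (1 + ε₀) ^ ((10 : ℝ) * k)) * (|Y 0 k t| + |Y 1 k t| + |Y 2 k t| + |Y 3 k t|) ≤ M
  /-- (6.44): a priori regularity of the energies. -/
  apriori_F : ∀ T : ℝ, τ (n₀ - N) < T → ∃ M : ℝ, ∀ t ∈ Icc (τ (n₀ - N)) T, ∀ k : ℤ,
    (1 + (1 + ε₀) ^ ((10 : ℝ) * k)) * Real.sqrt (F k t) ≤ M
  /-- (6.45): equation of motion of `a_k`. -/
  eq1 : ∀ k t, τ (n₀ - N) ≤ t →
    |derivWithin (Y 0 k) (Ici (τ (n₀ - N))) t - (1 + ε₀) ^ ((5 : ℝ) * k / 2) *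
        (-(ε ^ 2)⁻¹ * Y 2 k t * Y 3 k t - ε * Y 0 k t * Y 1 k t -
          ε ^ 2 * Real.exp (-K ^ 10) * Y 0 k t * Y 2 k t + K * Y 3 (k - 1) t ^ 2)| ≤
      C₁ * (1 + ε₀) ^ ((2 : ℝ) * k - n₀ / 2) * Real.sqrt (F k t)
  /-- (6.46): equation of motion of `b_k`. -/
  eq2 : ∀ k t, τ (n₀ - N) ≤ t →
    |derivWithin (Y 1 k) (Ici (τ (n₀ - N))) t - (1 + ε₀) ^ ((5 : ℝ) * k / 2) *
        (ε * Y 0 k t ^ 2 - ε⁻¹ * K ^ 10 * Y 2 k t ^ 2)| ≤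
      C₁ * (1 + ε₀) ^ ((2 : ℝ) * k - n₀ / 2) * Real.sqrt (F k t)
  /-- (6.47): equation of motion of `c_k`. -/
  eq3 : ∀ k t, τ (n₀ - N) ≤ t →
    |derivWithin (Y 2 k) (Ici (τ (n₀ - N))) t - (1 + ε₀) ^ ((5 : ℝ) * k / 2) *
        (ε ^ 2 * Real.exp (-K ^ 10) * Y 0 k t ^ 2 + ε⁻¹ * K ^ 10 * Y 1 k t * Y 2 k t)| ≤
      C₁ * (1 + ε₀) ^ ((2 : ℝ) * k - n₀ / 2) * Real.sqrt (F k t)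
  /-- (6.48): equation of motion of `d_k`. -/
  eq4 : ∀ k t, τ (n₀ - N) ≤ t →
    |derivWithin (Y 3 k) (Ici (τ (n₀ - N))) t - (1 + ε₀) ^ ((5 : ℝ) * k / 2) *
        ((ε ^ 2)⁻¹ * Y 2 k t * Y 0 k t -
          (1 + ε₀) ^ ((5 : ℝ) / 2) * K * Y 3 k t * Y 0 (k + 1) t)| ≤
      C₁ * (1 + ε₀) ^ ((2 : ℝ) * k - n₀ / 2) * Real.sqrt (F k t)
  /-- (6.49): the local energy inequality. -/
  energy : ∀ k t, τ (n₀ - N) ≤ t →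
    derivWithin (F k) (Ici (τ (n₀ - N))) t ≤
      K * (1 + ε₀) ^ ((5 : ℝ) * k / 2) *
        (Y 3 (k - 1) t ^ 2 * Y 0 k t - (1 + ε₀) ^ ((5 : ℝ) / 2) * Y 3 k t ^ 2 * Y 0 (k + 1) t)
  /-- (6.50): initial conditions, modes: `a_k(τ_{n₀-N}) = … = d_k(τ_{n₀-N}) = 0` for `k > n₀-N`. -/
  init_Y : ∀ i k, n₀ - N < k → Y i k (τ (n₀ - N)) = 0
  /-- (6.50): initial conditions, energies: `Ẽ_k(τ_{n₀-N}) = 0` for `k > n₀-N`. -/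
  init_F : ∀ k, n₀ - N < k → F k (τ (n₀ - N)) = 0
  /-- (6.51), lower bound: `½(a_k²+b_k²+c_k²+d_k²) ≤ Ẽ_k`. -/
  defect_lower : ∀ k t, τ (n₀ - N) ≤ t → (1 / 2) * ∑ i, Y i k t ^ 2 ≤ F k t
  /-- (6.51), upper bound, with implied constant `C₂`. -/
  defect_upper : ∀ k t, τ (n₀ - N) ≤ t →
    F k t ≤ (1 / 2) * ∑ i, Y i k t ^ 2 +
      C₂ * (1 + ε₀) ^ ((2 : ℝ) * k - n₀ / 2) * ∫ s in (τ (n₀ - N))..t, F k s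
  /-- (6.52): no very low frequencies, modes. -/
  noLow_Y : ∀ i k t, k < n₀ - N → τ (n₀ - N) ≤ t → Y i k t = 0
  /-- (6.52): no very low frequencies, energies. -/
  noLow_F : ∀ k t, k < n₀ - N → τ (n₀ - N) ≤ t → F k t = 0
  /-- (6.53), lower bound, with implied constant `C₃`: `-C₃ (1+ε₀)^{(5/2+1/100)|k|} ≤ τ_k`. -/
  tau_ge : ∀ k, n₀ - N ≤ k → k ≤ 0 →
    -(C₃ * (1 + ε₀) ^ (((5 : ℝ) / 2 + 1 / 100) * |(k : ℝ)|)) ≤ τ k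
  /-- (6.53), upper bound: `τ_k ≤ 0`. -/
  tau_le : ∀ k, n₀ - N ≤ k → k ≤ 0 → τ k ≤ 0
  /-- (6.54) `a₀(0) = 1`. -/
  a_eq : Y 0 0 0 = 1
  /-- (6.55) `|b₀(0)| ≤ 10⁻⁵ ε`. -/
  b_abs_le : |Y 1 0 0| ≤ 1 / 10 ^ 5 * ε
  /-- (6.56)_γ `|c₀(0)| ≤ γ ε²` (printed: `γ = 10⁻⁵ exp(-K¹⁰)`). -/
  c_abs_le : |Y 2 0 0| ≤ γ * ε ^ 2
  /-- (6.57) `c₀(0) ≥ -(1+ε₀)^{-n₀/4}`. -/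
  c_ge : -(1 + ε₀) ^ (-(n₀ : ℝ) / 4) ≤ Y 2 0 0
  /-- (6.58) `|d₀(0)| ≤ K^{-10}`. -/
  d_abs_le : |Y 3 0 0| ≤ (K ^ 10)⁻¹
  /-- (6.59) `Ẽ_{-1}(0) ≤ K^{-20}`. -/
  energy_prev_le : F (-1) 0 ≤ (K ^ 20)⁻¹
  /-- (6.60) if `N > n₀`: `b_{-1}(0) ≥ 10⁻⁵ ε`. -/
  b_prev_ge : n₀ < N → 1 / 10 ^ 5 * ε ≤ Y 1 (-1) 0
  /-- (6.61) if `N > n₀`: `b_{-1}(0) ≤ 10⁵ ε`. -/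
  b_prev_le : n₀ < N → Y 1 (-1) 0 ≤ 10 ^ 5 * ε
  /-- (6.62) if `N > n₀`: `c_{-1}(0) ≥ exp(K⁹) ε²`. -/
  c_prev_ge : n₀ < N → Real.exp (K ^ 9) * ε ^ 2 ≤ Y 2 (-1) 0
  /-- (6.63) if `N > n₀`: `c_{-1}(0) ≤ exp(K¹⁰) ε²`. -/
  c_prev_le : n₀ < N → Y 2 (-1) 0 ≤ Real.exp (K ^ 10) * ε ^ 2
  /-- (6.64): for `n₀-N < k ≤ 0`, `m ≥ 2`, `τ_{k-1} ≤ t ≤ τ_k`: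
  `Ẽ_{k-m}(t) ≤ K^{-10} (1+ε₀)^{m/10 + |k-1|/50}`. -/
  en_before : ∀ k, n₀ - N < k → k ≤ 0 → ∀ m : ℕ, 2 ≤ m → ∀ t ∈ Icc (τ (k - 1)) (τ k),
    F (k - m) t ≤ (K ^ 10)⁻¹ * (1 + ε₀) ^ ((m : ℝ) / 10 + |(k : ℝ) - 1| / 50)
  /-- (6.65): for `n₀-N < k ≤ 0`, `τ_{k-1} ≤ t ≤ τ_k`: `Ẽ_{k-1}(t) + Ẽ_k(t) ≤ (1+ε₀)^{|k-1|/50}`. -/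
  en_during : ∀ k, n₀ - N < k → k ≤ 0 → ∀ t ∈ Icc (τ (k - 1)) (τ k),
    F (k - 1) t + F k t ≤ (1 + ε₀) ^ (|(k : ℝ) - 1| / 50)
  /-- (6.66): for `n₀-N < k ≤ 0`, `m ≥ 1`, `τ_{k-1} ≤ t ≤ τ_k`:
  `Ẽ_{k+m}(t) ≤ K^{-30} (1+ε₀)^{-10m + |k-1|/50}`. -/
  en_after : ∀ k, n₀ - N < k → k ≤ 0 → ∀ m : ℕ, 1 ≤ m → ∀ t ∈ Icc (τ (k - 1)) (τ k),
    F (k + m) t ≤ (K ^ 30)⁻¹ * (1 + ε₀) ^ (-(10 : ℝ) * m + |(k : ℝ) - 1| / 50)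

/-! ## The conclusion of Proposition 6.5 -/

/-- **The conclusion (6.67)–(6.81) of Tao's Prop. 6.5** for a rescaled next checkpoint time `τ₁` and
amplitude `μ₁`, with `X₃`-coefficient `γ` in (6.71): (6.67) `1/100 ≤ τ₁ ≤ 100`;
(6.68) `(1+ε₀)^{-1/100} ≤ μ₁ ≤ (1+ε₀)^{1/100}`; (6.69) `a₁(τ₁) = μ₁`; (6.70) `|b₁(τ₁)| ≤ 10⁻⁵ ε μ₁`;
(6.71)_γ `|c₁(τ₁)| ≤ γ ε² μ₁`; (6.72) `c₁(τ₁) ≥ -(1+ε₀)^{-n₀/4} μ₁`; (6.73) `|d₁(τ₁)| ≤ K^{-10} μ₁`;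
(6.74) `Ẽ₀(τ₁) ≤ K^{-20} μ₁²`; (6.75)–(6.76) `10⁻⁵ ε μ₁ ≤ b₀(τ₁) ≤ 10⁵ ε μ₁`; (6.77)–(6.78)
`exp(K⁹) ε² μ₁ ≤ c₀(τ₁) ≤ exp(K¹⁰) ε² μ₁`; and for `0 ≤ t ≤ τ₁`: (6.79)
`Ẽ_{1-m}(t) ≤ K^{-10} (1+ε₀)^{m/10}` (`m ≥ 2`), (6.80) `Ẽ₀(t) + Ẽ₁(t) ≤ 1`, (6.81)
`Ẽ_{1+m}(t) ≤ K^{-30} (1+ε₀)^{-10m}` (`m ≥ 1`). [cite: Tao2016AveragedNS, §6.4 Prop. 6.5 (6.67)–(6.81)] -/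
structure RescaledConclusion (γ ε₀ K ε : ℝ) (n₀ : ℤ) (Y : Fin 4 → ℤ → ℝ → ℝ) (F : ℤ → ℝ → ℝ)
    (τ₁ μ₁ : ℝ) : Prop where
  /-- (6.67), lower: `1/100 ≤ τ₁`. -/
  tau_ge : 1 / 100 ≤ τ₁
  /-- (6.67), upper: `τ₁ ≤ 100`. -/
  tau_le : τ₁ ≤ 100
  /-- (6.68), lower: `(1+ε₀)^{-1/100} ≤ μ₁`. -/
  mu_ge : (1 + ε₀) ^ (-(1 : ℝ) / 100) ≤ μ₁
  /-- (6.68), upper: `μ₁ ≤ (1+ε₀)^{1/100}`. -/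
  mu_le : μ₁ ≤ (1 + ε₀) ^ ((1 : ℝ) / 100)
  /-- (6.69) `a₁(τ₁) = μ₁`. -/
  a_eq : Y 0 1 τ₁ = μ₁
  /-- (6.70) `|b₁(τ₁)| ≤ 10⁻⁵ ε μ₁`. -/
  b_abs_le : |Y 1 1 τ₁| ≤ 1 / 10 ^ 5 * ε * μ₁
  /-- (6.71)_γ `|c₁(τ₁)| ≤ γ ε² μ₁` (printed: `γ = 10⁻⁵ exp(-K¹⁰)`). -/
  c_abs_le : |Y 2 1 τ₁| ≤ γ * ε ^ 2 * μ₁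
  /-- (6.72) `c₁(τ₁) ≥ -(1+ε₀)^{-n₀/4} μ₁`. -/
  c_ge : -((1 + ε₀) ^ (-(n₀ : ℝ) / 4) * μ₁) ≤ Y 2 1 τ₁
  /-- (6.73) `|d₁(τ₁)| ≤ K^{-10} μ₁`. -/
  d_abs_le : |Y 3 1 τ₁| ≤ (K ^ 10)⁻¹ * μ₁
  /-- (6.74) `Ẽ₀(τ₁) ≤ K^{-20} μ₁²`. -/
  energy_le : F 0 τ₁ ≤ (K ^ 20)⁻¹ * μ₁ ^ 2
  /-- (6.75) `b₀(τ₁) ≥ 10⁻⁵ ε μ₁`. -/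
  b_prev_ge : 1 / 10 ^ 5 * ε * μ₁ ≤ Y 1 0 τ₁
  /-- (6.76) `b₀(τ₁) ≤ 10⁵ ε μ₁`. -/
  b_prev_le : Y 1 0 τ₁ ≤ 10 ^ 5 * ε * μ₁
  /-- (6.77) `c₀(τ₁) ≥ exp(K⁹) ε² μ₁`. -/
  c_prev_ge : Real.exp (K ^ 9) * ε ^ 2 * μ₁ ≤ Y 2 0 τ₁
  /-- (6.78) `c₀(τ₁) ≤ exp(K¹⁰) ε² μ₁`. -/
  c_prev_le : Y 2 0 τ₁ ≤ Real.exp (K ^ 10) * ε ^ 2 * μ₁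
  /-- (6.79): for `m ≥ 2` and `0 ≤ t ≤ τ₁`, `Ẽ_{1-m}(t) ≤ K^{-10} (1+ε₀)^{m/10}`. -/
  en_before : ∀ m : ℕ, 2 ≤ m → ∀ t ∈ Icc 0 τ₁, F (1 - m) t ≤ (K ^ 10)⁻¹ * (1 + ε₀) ^ ((m : ℝ) / 10)
  /-- (6.80): for `0 ≤ t ≤ τ₁`, `Ẽ₀(t) + Ẽ₁(t) ≤ 1`. -/
  en_during : ∀ t ∈ Icc 0 τ₁, F 0 t + F 1 t ≤ 1
  /-- (6.81): for `m ≥ 1` and `0 ≤ t ≤ τ₁`, `Ẽ_{1+m}(t) ≤ K^{-30} (1+ε₀)^{-10m}`. -/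
  en_after : ∀ m : ℕ, 1 ≤ m → ∀ t ∈ Icc 0 τ₁,
    F (1 + m) t ≤ (K ^ 30)⁻¹ * (1 + ε₀) ^ (-(10 : ℝ) * m)

/-! ## Proposition 6.5: the uniform statement schema and its two (deprecated) closed instances -/

/-- **Tao's Proposition 6.5 (rescaled inductive step) with `X₃`-coefficient `γ = γ(K)` in
(6.56)/(6.71), in the UNIFORM quantifier prefix** `∀ ε₀ ∈ (0,1), ∃ K₀, ∀ K ≥ K₀ (K > 0), ∃ e₀ > 0,
∀ ε ∈ (0,e₀], ∀ C₁ C₂ C₃ ≥ 0, ∃ N₀, ∀ n₀ ≥ N₀, ∀ N ≥ n₀`: if rescaled times `τ_{n₀-N} < … < τ₀ = 0`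
and `C¹` functions `a_k, b_k, c_k, d_k, Ẽ_k ≥ 0` on `[τ_{n₀-N}, +∞)` obey (i)–(ix) with implied
constants `C₁` ((6.45)–(6.48)), `C₂` ((6.51)), `C₃` ((6.53)) (`RescaledHypotheses`), then some
`τ₁, μ₁` obey (6.67)–(6.81) (`RescaledConclusion`). A statement schema (a parametrised predicate, not
a named fact; for `γ < 0` the hypothesis (6.56)_γ is unsatisfiable and the schema holds vacuously).
**Caveat (verdict clean-up 2026-08-15).** This prefix takes `K₀, e₀` uniform in the constant `C₃` of
(6.53), which is STRONGER than the printed Prop. 6.5 read with the convention of §6.1 ("we allow all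
implied constants in the `O()` notation to depend on `ε₀`"; `K` "sufficiently large depending on
`ε₀`") and than what the printed proof gives (Prop. 6.13, (6.120)–(6.125), takes `K` large compared
with the constant of (6.53); see the module docstring). The source-faithful schema is
`rescaledStepWith' γ` of `TaoCascadeRescaledStepOrder.lean` (`C₃` fixed before `K₀`), implied by this
one (`rescaledStepWith.weaken`); by `not_rescaledHypotheses_of_rescaledStepWith`
(`TaoCascadeRescaledIteration.lean`) the present schema is equivalent to the unsatisfiability, in its
own regime, of its hypotheses. Kept (body unchanged) because those theorems are stated for it; not
asserted for any `γ`. [cite: Tao2016AveragedNS, §6.4 Prop. 6.5 (statement schema; uniform-in-C₃ prefix, stronger than printed — see docstring)] -/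
def rescaledStepWith (γ : ℝ → ℝ) : Prop :=
  ∀ ε₀ : ℝ, 0 < ε₀ → ε₀ < 1 →
    ∃ K₀ : ℝ, ∀ K : ℝ, K₀ ≤ K → 0 < K →
      ∃ e₀ : ℝ, 0 < e₀ ∧ ∀ ε : ℝ, 0 < ε → ε ≤ e₀ →
        ∀ C₁ C₂ C₃ : ℝ, 0 ≤ C₁ → 0 ≤ C₂ → 0 ≤ C₃ →
          ∃ N₀ : ℤ, ∀ n₀ : ℤ, N₀ ≤ n₀ → ∀ N : ℤ, n₀ ≤ N →
            ∀ (τ : ℤ → ℝ) (Y : Fin 4 → ℤ → ℝ → ℝ) (F : ℤ → ℝ → ℝ),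
              RescaledHypotheses (γ K) ε₀ K ε C₁ C₂ C₃ n₀ N τ Y F →
                ∃ τ₁ μ₁ : ℝ, RescaledConclusion (γ K) ε₀ K ε n₀ Y F τ₁ μ₁

/-- **Deprecated (verdict clean-up 2026-08-15) — MIS-STATED; use `rescaledStepCorrected'` of
`TaoCascadeRescaledStepOrder.lean`.** Tao's Prop. 6.5 with the printed `X₃`-coefficient
`10⁻⁵ exp(-K¹⁰)` in (6.56)/(6.71), in the uniform quantifier prefix of `rescaledStepWith`. Two
defects: (a) the printed constant of (6.71) is not delivered by the printed proof — Prop. 6.12 is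
derived from Props. 6.13 + 6.15 and (6.117) only gives `|c₁(t)| ≲ K^{-1/4} exp(-K¹⁰/2) ε²`
(reader's report of 2017-03-31, acknowledged by the author: "this will be corrected in the next
version of the ms."; arXiv v3 is the latest, the fix being `exp(-K¹⁰) ↦ exp(-K¹⁰/2)` in (6.17),
(6.32), (6.71), (6.108)); (b) the prefix chooses `K₀` before the constant `C₃` of (6.53), whereas
the source (§6.1 convention) and its proof (Prop. 6.13, (6.120)–(6.125)) have `K` large depending on
it. What is proved about this statement stands: `rescaledStepPrinted_of_corrected`
(`rescaledStepCorrected → rescaledStepPrinted`, vacuously) and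
`rescaledStepPrinted_iff_not_rescaledHypotheses` in `TaoCascadeRescaledIteration.lean`. Body kept for
those users; do not use in new code.
[cite: Tao2016AveragedNS, §6.4 Prop. 6.5 as printed and as mis-rendered here (uniform-in-C₃ prefix) — corrected statement: rescaledStepCorrected' (TaoCascadeRescaledStepOrder.lean); erratum: TaoBlog2014AveragedNSErratum] -/
@[deprecated "mis-stated (printed (6.71) constant not established by the printed proof — author-acknowledged erratum; and K₀ must be allowed to depend on the constant C₃ of (6.53)): use Literature.Analysis.FluidPDE.TaoCascade.rescaledStepCorrected' of TaoCascadeRescaledStepOrder.lean" (since := "2026-08-15")]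
def rescaledStepPrinted : Prop :=
  rescaledStepWith fun K => 1 / 10 ^ 5 * Real.exp (-K ^ 10)

/-- **Deprecated (verdict clean-up 2026-08-15) — MIS-STATED; use `rescaledStepCorrected'` of
`TaoCascadeRescaledStepOrder.lean`.** Tao's Prop. 6.5 with the author-corrected `X₃`-coefficient
`10⁻⁵ exp(-K¹⁰/2)` in (6.56)/(6.71) (matching Prop. 6.13 (6.117)), but in the uniform quantifier
prefix of `rescaledStepWith`: `K₀` (and `e₀`) are chosen before the implied constant `C₃` of the
scale-evolution hypothesis (6.53). The source does not state this uniformity — §6.1: "we allow all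
implied constants in the `O()` notation to depend on `ε₀`", `K` "sufficiently large depending on
`ε₀`" — and its proof does not give it: Prop. 6.13 ((6.120)–(6.125)) bounds
`Ẽ₁(t) ≲ K^{-30}/(1+|t|³)` on the rescaled past "from this and (6.53)" with a constant polynomial in
that of (6.53) and closes the bootstrap `∫ |b₁| ≤ ε/10` only "if `K` is [large] enough". The
corrected statement, with `∀ ε₀, ∀ C₃ ≥ 0, ∃ K₀, …`, is the named fact `rescaledStepCorrected'`
(downstream, hence not importable here); `rescaledStepCorrected.weaken : rescaledStepCorrected →
rescaledStepCorrected'` and `noGlobalODESolution_of_rescaledStepCorrected` are its remaining users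
there. Body kept for them; do not use in new code.
[cite: Tao2016AveragedNS, §6.4 Prop. 6.5 with §6.6 Prop. 6.13 (6.117), as mis-rendered here (uniform-in-C₃ prefix) — corrected statement: rescaledStepCorrected' (TaoCascadeRescaledStepOrder.lean)] -/
@[deprecated "mis-stated (K₀ is chosen before the constant C₃ of (6.53); the source, §6.1 and Prop. 6.13 (6.120)–(6.125), has K large depending on it): use Literature.Analysis.FluidPDE.TaoCascade.rescaledStepCorrected' of TaoCascadeRescaledStepOrder.lean" (since := "2026-08-15")]
def rescaledStepCorrected : Prop :=
  rescaledStepWith fun K => 1 / 10 ^ 5 * Real.exp (-K ^ 10 / 2)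

/-! ## Small API: the conclusion in the packaging of Props. 6.3/6.4 -/

section API

variable {γ ε₀ K ε : ℝ} {n₀ : ℤ} {Y : Fin 4 → ℤ → ℝ → ℝ} {F : ℤ → ℝ → ℝ} {τ₁ μ₁ : ℝ}

/-- The rescaled next amplitude is positive (from (6.68) and `ε₀ > -1`).
[cite: Tao2016AveragedNS, §6.4 Prop. 6.5 (6.68)] -/
theorem RescaledConclusion.mu_pos (h : RescaledConclusion γ ε₀ K ε n₀ Y F τ₁ μ₁) (hε₀ : -1 < ε₀) :
    0 < μ₁ :=
  (Real.rpow_pos_of_pos (by linarith) _).trans_le h.mu_ge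

/-- (6.69)–(6.74) are the transition-state bounds (viii) of Prop. 6.3 at scale `1`, time `τ₁`,
amplitude `μ₁` (coefficient `γ`). [cite: Tao2016AveragedNS, §6.4 Prop. 6.5 (6.69)–(6.74)] -/
theorem RescaledConclusion.stateBoundsWith (h : RescaledConclusion γ ε₀ K ε n₀ Y F τ₁ μ₁)
    (hε₀ : -1 < ε₀) : StateBoundsWith γ ε₀ K ε n₀ Y F 1 τ₁ μ₁ where
  pos := h.mu_pos hε₀
  x1_eq := h.a_eq
  x2_abs_le := h.b_abs_le
  x3_abs_le := h.c_abs_le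
  x3_ge := h.c_ge
  x4_abs_le := h.d_abs_le
  energy_prev_le := by simpa using h.energy_le

/-- (6.67)–(6.68), (6.75)–(6.81) are the scale-evolution / additional / energy bounds of Prop. 6.3 for
the passage from scale `0` (time `0`, amplitude `1`) to scale `1` (time `τ₁`, amplitude `μ₁`).
[cite: Tao2016AveragedNS, §6.4 Prop. 6.5 (6.67)–(6.68), (6.75)–(6.81)] -/
theorem RescaledConclusion.stepBounds (h : RescaledConclusion γ ε₀ K ε n₀ Y F τ₁ μ₁) :
    StepBounds ε₀ K ε Y F 1 0 τ₁ 1 μ₁ where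
  lt := by linarith [h.tau_ge]
  amp_ge := by simpa using h.mu_ge
  amp_le := by simpa using h.mu_le
  life_ge := by norm_num; exact h.tau_ge
  life_le := by norm_num; exact h.tau_le
  x2_prev_ge := by simpa using h.b_prev_ge
  x2_prev_le := by simpa using h.b_prev_le
  x3_prev_ge := by simpa using h.c_prev_ge
  x3_prev_le := by simpa using h.c_prev_le
  en_before m hm t ht := by simpa using h.en_before m hm t ht
  en_during t ht := by simpa using h.en_during t ht
  en_after m hm t ht := by simpa using h.en_after m hm t ht

/-- Conversely, transition-state bounds at scale `1` and step bounds from `(0, 1)` to `(τ₁, μ₁)` with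
`τ₁ ≤ 100` make up the conclusion of Prop. 6.5. [cite: Tao2016AveragedNS, §6.4 Prop. 6.5 (6.67)–(6.81)] -/
theorem RescaledConclusion.of_bounds (hst : StateBoundsWith γ ε₀ K ε n₀ Y F 1 τ₁ μ₁)
    (hsp : StepBounds ε₀ K ε Y F 1 0 τ₁ 1 μ₁) (hτ : τ₁ ≤ 100) :
    RescaledConclusion γ ε₀ K ε n₀ Y F τ₁ μ₁ where
  tau_ge := by have := hsp.life_ge; norm_num at this; exact this
  tau_le := hτ
  mu_ge := by simpa using hsp.amp_ge
  mu_le := by simpa using hsp.amp_le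
  a_eq := hst.x1_eq
  b_abs_le := hst.x2_abs_le
  c_abs_le := hst.x3_abs_le
  c_ge := hst.x3_ge
  d_abs_le := hst.x4_abs_le
  energy_le := by simpa using hst.energy_prev_le
  b_prev_ge := by simpa using hsp.x2_prev_ge
  b_prev_le := by simpa using hsp.x2_prev_le
  c_prev_ge := by simpa using hsp.x3_prev_ge
  c_prev_le := by simpa using hsp.x3_prev_le
  en_before m hm t ht := by simpa using hsp.en_before m hm t ht
  en_during t ht := by simpa using hsp.en_during t ht
  en_after m hm t ht := by simpa using hsp.en_after m hm t ht

/-- (6.54)–(6.59) are the transition-state bounds (viii) of Prop. 6.3 at scale `0`, time `0`,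
amplitude `1`. [cite: Tao2016AveragedNS, §6.4 Prop. 6.5 (6.54)–(6.59)] -/
theorem RescaledHypotheses.stateBoundsWith_zero {C₁ C₂ C₃ : ℝ} {N : ℤ} {τ : ℤ → ℝ}
    (h : RescaledHypotheses γ ε₀ K ε C₁ C₂ C₃ n₀ N τ Y F) :
    StateBoundsWith γ ε₀ K ε n₀ Y F 0 0 1 where
  pos := one_pos
  x1_eq := h.a_eq
  x2_abs_le := by simpa using h.b_abs_le
  x3_abs_le := by simpa using h.c_abs_le
  x3_ge := by simpa using h.c_ge
  x4_abs_le := by simpa using h.d_abs_le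
  energy_prev_le := by simpa using h.energy_prev_le

end API

end TaoCascade

end Literature.Analysis.FluidPDE
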